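import Summits.AtomisticToContinuum.Crystallization.Theorems.ChartedZeroExcessLayeredLatticeLiouvilleZZZYRCVL
import Summits.AtomisticToContinuum.Crystallization.Theorems.ChartedZeroExcessLayeredLatticeLiouvilleZZZYRCXL

/-!
# Charted zero-excess layered-lattice Liouville — ZZZYRCX: the θ⁰ READER STATEMENT (route (B) objects, contracts, class covers, periodicity)

Cell `decomp-a2c`, lens 2, generation 100; shape of record `ThetaReaderShape` (critic r1842, r1851 (B)).  Line (D) TAIL-DEBIT of
`UniformEquilStabilityAt`: the per-box scheme obligation `BoxSchemeP` (ZZZYRCHA) is read from a THREE-WAY COVER of the far pairs of a box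
word — NEAR (ideal `n9 ≤ 5184 = 9·24²`: enumerated chord DATA, the θ⁰ slabs checked by hand-1's kernel ZZZYRCXK/RCXL), MIDDLE (ideal
`n9 > 5184`, actual `‖e‖ ≤ 64`: king paths + decided Ξ slabs, ZZZYRCV…RCVP) and FAR-FAR (`‖e‖ > 64`: the closed king remainder of ZZZYRCR).
This file puts on the tree the objects all three meet on (the sequel ZZZYRCY proves the registry floor lemma, the middle placement `hgeo`
and the three-way box reader):

§1 the integer IDEAL geometry of a Barlow word `wd : List ℤ` (registry letters 0/1/2 over one period `p = wd.length`) on the index type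
   `Cell 2 × ℤ`: `regW`, refined thirds `refW0 / refW1`, `n9W x = 9·|ideal e_x|²`, `d18W x q = 18·⟨ideal e_x, ideal e_q⟩`, `pieceKeyW`;
§2 CHORD DATA (`ChordDatum` = a based far pair `((0, m), Y)`, `0 ≤ m < p`, with its interior path sites) and the path system READ OFF
   the data (`toBase`, `dataLookup`, `dataNp`, `dataZ`; endpoints hold by construction, so validity = piece lengths only);
§3 the ideal near class `IdealNear wd hi`, VALIDITY `ChordDataValid wd lo hi P9max cd` (based, in class, pieces `0 < n9 ≤ P9max`, no
   duplicate chords, COMPLETE) and the exact IDEAL TABLES `thetaR0 / thetaN0` per piece key (`n·45927/n9⁴`, `45927 = 7·9⁴`; ideal `sin²`);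
§4 the BOX COMPARISONS a box file supplies per word: `IdealLengthCmp wd λ μ` (`λ²·n9 ≤ 9‖e_x‖² ≤ μ²·n9`) and `IdealAngleCmp wd K η`;
§5 ★ the NEAR READER CONTRACT `ThetaReaderNear` (validity + table majorants + the comparisons ⇒ `IsPathSystemOn` and
   `SchemeDominatedOnP` on `IdealNear wd hi`, tables `(1+α)λ⁻⁸·TR ∘ key` and `(1+α⁻¹)λ⁻⁸·(K·TN + η·TR) ∘ key`; proved in a lens-2
   sequel) and the KERNEL CONTRACT `KernelSlabSound` (the right-hand side hand-1's decode of `slabAcc_sound` must reach);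
§6 CLASS COVERS: domination / path systems on two classes covering a third pass to the third under ANY decidable cut (RCL/RCT split
   at an actual length; the three-way cover splits at the IDEAL length);
§7 PERIODICITY: `regW` is `p`-periodic and `n9W` is invariant under a common in-plane translation and layer shift by a multiple of `p`,
   hence `n9W wd (toBase p x) = n9W wd x` — the ideal class of a pair is read on its base representative (`idealNear_iff`); letters of a
   `{0,1,2}`-word are in `[0, 2]` (`regW_bounds`, the hypothesis shape of hand-1's `walkP_sound`).

Every item is a definition or a proved lemma; the two contracts are `Prop`s consumed as hypotheses downstream (WEAKER than any summit
statement: they speak of one word's finite data).  Definition file (28 defs, 11 theorems); imports ZZZYRCVL (⊇ RCV ⊇ RCT) and hand-1's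
ZZZYRCXL (so that hand-1's decode file and the sequel have one parent); no instance / notation / option; 0 sorry. [g100]
-/

namespace Summit.AtomisticToContinuum.Crystallization.Theorems.ChartedZeroExcessLayeredLatticeLiouville

open scoped BigOperators RealInnerProductSpace
open Summit.AtomisticToContinuum.Crystallization.Theorems.ChartedPlanarOrderRigidityDoor (E3)

/-! ### §1 integer ideal geometry of a Barlow word -/

/-- registry letter (0 = A, 1 = B, 2 = C) of layer `m` for the periodic word `wd`. [g100] -/
def regW (wd : List ℤ) (m : ℤ) : ℤ := wd.getD ((m % (wd.length : ℤ)).toNat) 0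

/-- refined in-plane coordinate (thirds of `t₁`): `3γ₀ + reg m`. [g100] -/
def refW0 (wd : List ℤ) (s : Cell 2 × ℤ) : ℤ := 3 * s.1 0 + regW wd s.2
/-- refined in-plane coordinate (thirds of `t₂`): `3γ₁ + reg m`. [g100] -/
def refW1 (wd : List ℤ) (s : Cell 2 × ℤ) : ℤ := 3 * s.1 1 + regW wd s.2

/-- `9·|ideal e_x|²` for the pair `x = (s, t)`: `qhex(ΔR) + 6Δm²` with `qhex a b = a² + ab + b²` (60° basis). [g100] -/
def n9W (wd : List ℤ) (x : (Cell 2 × ℤ) × (Cell 2 × ℤ)) : ℤ :=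
  let a := refW0 wd x.2 - refW0 wd x.1
  let b := refW1 wd x.2 - refW1 wd x.1
  a * a + a * b + b * b + 6 * (x.2.2 - x.1.2) ^ 2

/-- `18·⟨ideal e_x, ideal e_q⟩` for two pairs. [g100] -/
def d18W (wd : List ℤ) (x q : (Cell 2 × ℤ) × (Cell 2 × ℤ)) : ℤ :=
  let a := refW0 wd x.2 - refW0 wd x.1
  let b := refW1 wd x.2 - refW1 wd x.1
  let a' := refW0 wd q.2 - refW0 wd q.1
  let b' := refW1 wd q.2 - refW1 wd q.1
  2 * a * a' + 2 * b * b' + a * b' + a' * b + 12 * (x.2.2 - x.1.2) * (q.2.2 - q.1.2)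

/-- the piece KEY `(m mod p, Δγ₀, Δγ₁, Δm)` (tables are invariant under in-plane translations and `m ↦ m + p`). [g100] -/
def pieceKeyW (p : ℕ) (q : (Cell 2 × ℤ) × (Cell 2 × ℤ)) : ℤ × ℤ × ℤ × ℤ :=
  (q.1.2 % (p : ℤ), q.2.1 0 - q.1.1 0, q.2.1 1 - q.1.1 1, q.2.2 - q.1.2)

/-! ### §2 chord data and the path system read off it -/

/-- a chord datum: the based far pair `(X, Y)` and its INTERIOR path sites (route (B) data). [g100] -/
abbrev ChordDatum := ((Cell 2 × ℤ) × (Cell 2 × ℤ)) × List (Cell 2 × ℤ)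

/-- the nodes `X :: interior ++ [Y]` of a datum (endpoints correct by construction). [g100] -/
def chordNodes (c : ChordDatum) : List (Cell 2 × ℤ) := c.1.1 :: (c.2 ++ [c.1.2])
/-- number of pieces of a datum. [g100] -/
def chordNp (c : ChordDatum) : ℕ := c.2.length + 1
/-- the `i`-th piece of a datum (junk beyond the end). [g100] -/
def chordPiece (c : ChordDatum) (i : ℕ) : (Cell 2 × ℤ) × (Cell 2 × ℤ) :=
  ((chordNodes c).getD i c.1.2, (chordNodes c).getD (i + 1) c.1.2)

/-- translate a site by an in-plane lattice vector and a layer shift. [g100] -/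
def shiftSiteW (γ : Cell 2) (dm : ℤ) (s : Cell 2 × ℤ) : Cell 2 × ℤ := (s.1 + γ, s.2 + dm)

/-- the layer shift (a multiple of the period) taking `x.1` to its base layer `x.1.2 mod p`. [g100] -/
def baseShift (p : ℕ) (x : (Cell 2 × ℤ) × (Cell 2 × ℤ)) : ℤ := x.1.2 - x.1.2 % (p : ℤ)

/-- the BASE REPRESENTATIVE of a pair: `x.1 ↦ (0, m mod p)`, `x.2` translated along. [g100] -/
def toBase (p : ℕ) (x : (Cell 2 × ℤ) × (Cell 2 × ℤ)) : (Cell 2 × ℤ) × (Cell 2 × ℤ) :=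
  (shiftSiteW (-x.1.1) (-baseShift p x) x.1, shiftSiteW (-x.1.1) (-baseShift p x) x.2)

/-- the datum of a pair (first datum whose based pair is `toBase p x`), if any. [g100] -/
def dataLookup (p : ℕ) (cd : List ChordDatum) (x : (Cell 2 × ℤ) × (Cell 2 × ℤ)) : Option ChordDatum :=
  cd.find? fun c => decide (c.1 = toBase p x)

/-- number of pieces READ OFF the data (default 1 = the pair itself). [g100] -/
def dataNp (p : ℕ) (cd : List ChordDatum) (x : (Cell 2 × ℤ) × (Cell 2 × ℤ)) : ℕ :=
  match dataLookup p cd x with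
  | some c => chordNp c
  | none => 1

/-- path nodes READ OFF the data, translated back to `x` (default: the one-piece path). [g100] -/
def dataZ (p : ℕ) (cd : List ChordDatum) (x : (Cell 2 × ℤ) × (Cell 2 × ℤ)) (i : ℕ) : Cell 2 × ℤ :=
  match dataLookup p cd x with
  | some c => shiftSiteW x.1.1 (baseShift p x) ((chordNodes c).getD i c.1.2)
  | none => if i = 0 then x.1 else x.2

/-! ### §3 validity and the ideal tables -/

/-- the IDEAL NEAR CLASS of a slab boundary `hi`: ideal squared length (in ninths) of the base representative at most `hi`. [g100] -/
def IdealNear (wd : List ℤ) (hi : ℤ) (x : (Cell 2 × ℤ) × (Cell 2 × ℤ)) : Prop := n9W wd (toBase wd.length x) ≤ hi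

/-- ★ VALID chord data for the ideal class `(lo, hi]` of the word `wd` with piece bound `P9max`. [g100] -/
def ChordDataValid (wd : List ℤ) (lo hi P9max : ℤ) (cd : List ChordDatum) : Prop :=
  (∀ c ∈ cd, c.1.1.1 = 0 ∧ 0 ≤ c.1.1.2 ∧ c.1.1.2 < (wd.length : ℤ) ∧ lo < n9W wd c.1 ∧ n9W wd c.1 ≤ hi ∧
      ∀ i < chordNp c, 0 < n9W wd (chordPiece c i) ∧ n9W wd (chordPiece c i) ≤ P9max) ∧
    (cd.map (·.1)).Nodup ∧
    ∀ x : (Cell 2 × ℤ) × (Cell 2 × ℤ), x.1.1 = 0 → 0 ≤ x.1.2 → x.1.2 < (wd.length : ℤ) → lo < n9W wd x → n9W wd x ≤ hi →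
      ∃ c ∈ cd, c.1 = x

/-- ideal R coefficient of one incidence: `n·7·9⁴/n9⁴` (`cos² ≤ 1`). [g100] -/
noncomputable def coefR0 (wd : List ℤ) (c : ChordDatum) : ℝ := (chordNp c : ℝ) * 45927 / (n9W wd c.1 : ℝ) ^ 4
/-- ideal N coefficient of incidence `i`: `n·7·9⁴·(1 − d18²/(4·n9·p9))/n9⁴` (ideal sin²). [g100] -/
noncomputable def coefN0 (wd : List ℤ) (c : ChordDatum) (i : ℕ) : ℝ :=
  (chordNp c : ℝ) * 45927 * (1 - (d18W wd c.1 (chordPiece c i) : ℝ) ^ 2 / (4 * n9W wd c.1 * n9W wd (chordPiece c i))) /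
    (n9W wd c.1 : ℝ) ^ 4

/-- ★ IDEAL R TABLE at key `k`: sum of `coefR0` over the incidences whose piece has key `k`. [g100] -/
noncomputable def thetaR0 (wd : List ℤ) (cd : List ChordDatum) (k : ℤ × ℤ × ℤ × ℤ) : ℝ :=
  (cd.map fun c => ∑ i ∈ Finset.range (chordNp c), if pieceKeyW wd.length (chordPiece c i) = k then coefR0 wd c else 0).sum
/-- ★ IDEAL N TABLE at key `k`. [g100] -/
noncomputable def thetaN0 (wd : List ℤ) (cd : List ChordDatum) (k : ℤ × ℤ × ℤ × ℤ) : ℝ :=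
  (cd.map fun c => ∑ i ∈ Finset.range (chordNp c), if pieceKeyW wd.length (chordPiece c i) = k then coefN0 wd c i else 0).sum

/-! ### §4 box comparison hypotheses -/

/-- LENGTH comparison of the actual word with the ideal word: `λ²·n9 ≤ 9‖e_x‖² ≤ μ²·n9` for every pair. [g100] -/
def IdealLengthCmp (wd : List ℤ) (lam mu : ℝ) (a b : E3) (w : ℤ → E3) : Prop :=
  ∀ x : (Cell 2 × ℤ) × (Cell 2 × ℤ),
    lam ^ 2 * (n9W wd x : ℝ) ≤ 9 * ‖bondVec a b w x‖ ^ 2 ∧ 9 * ‖bondVec a b w x‖ ^ 2 ≤ mu ^ 2 * (n9W wd x : ℝ)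

/-- actual `sin²` of the angle between two bond vectors (junk on zero vectors). [g100] -/
noncomputable def sinSqPair (a b : E3) (w : ℤ → E3) (x q : (Cell 2 × ℤ) × (Cell 2 × ℤ)) : ℝ :=
  1 - ⟪bondVec a b w x, bondVec a b w q⟫ ^ 2 / (‖bondVec a b w x‖ ^ 2 * ‖bondVec a b w q‖ ^ 2)
/-- ideal `sin²` between two pairs: `1 − d18²/(4·n9·n9')`. [g100] -/
noncomputable def sinSq0 (wd : List ℤ) (x q : (Cell 2 × ℤ) × (Cell 2 × ℤ)) : ℝ :=
  1 - (d18W wd x q : ℝ) ^ 2 / (4 * n9W wd x * n9W wd q)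

/-- ANGLE comparison: `sin²_actual ≤ K·sin²_ideal + η` for all pairs of nonzero ideal length (the angle lemma (d) supplies `K, η`
per box). [g100] -/
def IdealAngleCmp (wd : List ℤ) (K η : ℝ) (a b : E3) (w : ℤ → E3) : Prop :=
  ∀ x q : (Cell 2 × ℤ) × (Cell 2 × ℤ), 0 < n9W wd x → 0 < n9W wd q → sinSqPair a b w x q ≤ K * sinSq0 wd x q + η

/-! ### §5 the reader contract and the kernel contract -/

/-- ★★ THE NEAR READER CONTRACT (route (B)): valid data + table majorants + the two comparisons ⇒ path system and table domination on
the ideal near class, with the box scalars factored out of the word-indexed tables (`0 ≤ ϱ` is NEEDED: for `ϱ < 0` the zero pair `(s, s)`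
is far and ideal-near and its default one-piece path has length `0`). [g100] -/
def ThetaReaderNear : Prop :=
  ∀ (wd : List ℤ) (lo hi P9max : ℤ) (cd : List ChordDatum) (TR TN : ℤ × ℤ × ℤ × ℤ → ℝ) (ϱ α lam mu K η : ℝ)
    (a b : E3) (w : ℤ → E3),
    0 < wd.length → 0 ≤ ϱ → 0 < α → 0 < lam → 0 ≤ K → 0 ≤ η →
    ChordDataValid wd lo hi P9max cd → (∀ k, thetaR0 wd cd k ≤ TR k) → (∀ k, thetaN0 wd cd k ≤ TN k) → (∀ k, 0 ≤ TR k) →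
    IdealLengthCmp wd lam mu a b w → IdealAngleCmp wd K η a b w →
    mu ^ 2 * (P9max : ℝ) ≤ 9 * ϱ ^ 2 → mu ^ 2 * (lo : ℝ) ≤ 9 * ϱ ^ 2 →
    IsPathSystemOn ϱ a b w (IdealNear wd hi) (dataNp wd.length cd) (dataZ wd.length cd) ∧
      SchemeDominatedOnP ϱ α a b w (dataNp wd.length cd) (dataZ wd.length cd) (IdealNear wd hi)
        (fun y => (1 + α) * (lam ^ 8)⁻¹ * TR (pieceKeyW wd.length y))
        (fun y => (1 + α⁻¹) * (lam ^ 8)⁻¹ * (K * TN (pieceKeyW wd.length y) + η * TR (pieceKeyW wd.length y)))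

/-- the KERNEL CONTRACT: what hand-1's decode of `slabAcc_sound` (ZZZYRCXL) concludes from a successful slab check (`TRz/TNz` the
integer tables at dyadic exponent `E`). [g100] -/
def KernelSlabSound (wd : List ℤ) (lo hi P9max : ℤ) (E : ℕ) (cd : List ChordDatum) (TRz TNz : ℤ × ℤ × ℤ × ℤ → ℤ) : Prop :=
  ChordDataValid wd lo hi P9max cd ∧
    ∀ k, thetaR0 wd cd k ≤ (TRz k : ℝ) / 2 ^ E ∧ thetaN0 wd cd k ≤ (TNz k : ℝ) / 2 ^ E

/-! ### §6 class covers (any decidable cut) -/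

/-- domination on two classes covering a third gives domination on the third with the summed tables (generalises RCL's actual-length
split to any classes, e.g. the IDEAL cut `IdealNear` / its complement). [g100] -/
theorem schemeDominatedOnP_of_cover {ϱ α : ℝ} {a b : E3} {w : ℤ → E3} {np : (Cell 2 × ℤ) × (Cell 2 × ℤ) → ℕ}
    {z : (Cell 2 × ℤ) × (Cell 2 × ℤ) → ℕ → Cell 2 × ℤ} {P Q S : (Cell 2 × ℤ) × (Cell 2 × ℤ) → Prop} [DecidablePred P]
    {ΘR₁ ΘN₁ ΘR₂ ΘN₂ : (Cell 2 × ℤ) × (Cell 2 × ℤ) → ℝ} (hPQ : ∀ x, S x → ¬P x → Q x)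
    (h₁ : SchemeDominatedOnP ϱ α a b w np z P ΘR₁ ΘN₁) (h₂ : SchemeDominatedOnP ϱ α a b w np z Q ΘR₂ ΘN₂) :
    SchemeDominatedOnP ϱ α a b w np z S (fun y => ΘR₁ y + ΘR₂ y) (fun y => ΘN₁ y + ΘN₂ y) := by
  classical
  intro X hX y
  have hsplit : ∀ f : (Cell 2 × ℤ) × (Cell 2 × ℤ) → ℝ,
      ∑ x ∈ X, f x = ∑ x ∈ X.filter (fun x => P x), f x + ∑ x ∈ X.filter (fun x => ¬P x), f x := fun f =>
    (Finset.sum_filter_add_sum_filter_not X (fun x => P x) f).symm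
  have hX₁ : ∀ x ∈ X.filter (fun x => P x), ϱ < ‖bondVec a b w x‖ ∧ P x := fun x hx => by
    rw [Finset.mem_filter] at hx; exact ⟨(hX x hx.1).1, hx.2⟩
  have hX₂ : ∀ x ∈ X.filter (fun x => ¬P x), ϱ < ‖bondVec a b w x‖ ∧ Q x := fun x hx => by
    rw [Finset.mem_filter] at hx; exact ⟨(hX x hx.1).1, hPQ x (hX x hx.1).2 hx.2⟩
  obtain ⟨hR₁, hN₁⟩ := h₁ _ hX₁ y
  obtain ⟨hR₂, hN₂⟩ := h₂ _ hX₂ y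
  constructor
  · rw [hsplit]; exact add_le_add hR₁ hR₂
  · rw [hsplit]; exact add_le_add hN₁ hN₂

/-- path systems on two classes covering a third, spliced by the decidable class `P`, give a path system on the third. [g100] -/
theorem isPathSystemOn_of_cover {ϱ : ℝ} {a b : E3} {w : ℤ → E3} {np₁ np₂ : (Cell 2 × ℤ) × (Cell 2 × ℤ) → ℕ}
    {z₁ z₂ : (Cell 2 × ℤ) × (Cell 2 × ℤ) → ℕ → Cell 2 × ℤ} {P Q S : (Cell 2 × ℤ) × (Cell 2 × ℤ) → Prop} [DecidablePred P]
    (hPQ : ∀ x, S x → ¬P x → Q x)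
    (h₁ : IsPathSystemOn ϱ a b w P np₁ z₁) (h₂ : IsPathSystemOn ϱ a b w Q np₂ z₂) :
    IsPathSystemOn ϱ a b w S (fun x => if P x then np₁ x else np₂ x) (fun x => if P x then z₁ x else z₂ x) := by
  intro x hx hS
  by_cases hP : P x
  · have h := h₁ x hx hP
    simp only [hP, if_true, piece] at h ⊢
    exact h
  · have h := h₂ x hx (hPQ x hS hP)
    simp only [hP, if_false, piece] at h ⊢
    exact h

/-- the spliced tables agree with the class-wise data: domination transfers to the spliced path system (class `P` side). [g100] -/
theorem schemeDominatedOnP_splice_of_class {ϱ α : ℝ} {a b : E3} {w : ℤ → E3} {np₁ np₂ : (Cell 2 × ℤ) × (Cell 2 × ℤ) → ℕ}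
    {z₁ z₂ : (Cell 2 × ℤ) × (Cell 2 × ℤ) → ℕ → Cell 2 × ℤ} {P : (Cell 2 × ℤ) × (Cell 2 × ℤ) → Prop} [DecidablePred P]
    {ΘR ΘN : (Cell 2 × ℤ) × (Cell 2 × ℤ) → ℝ} (h : SchemeDominatedOnP ϱ α a b w np₁ z₁ P ΘR ΘN) :
    SchemeDominatedOnP ϱ α a b w (fun x => if P x then np₁ x else np₂ x) (fun x => if P x then z₁ x else z₂ x) P ΘR ΘN := by
  classical
  intro X hX y
  have hx : ∀ x ∈ X, (fun x => if P x then np₁ x else np₂ x) x = np₁ x ∧ (fun x => if P x then z₁ x else z₂ x) x = z₁ x :=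
    fun x hx => by constructor <;> simp only [(hX x hx).2, if_true]
  obtain ⟨hR, hN⟩ := h X hX y
  constructor
  · refine le_trans (le_of_eq (Finset.sum_congr rfl fun x hxX => ?_)) hR
    exact (schemeSums_congr (hx x hxX).1 (hx x hxX).2 y).1
  · refine le_trans (le_of_eq (Finset.sum_congr rfl fun x hxX => ?_)) hN
    exact (schemeSums_congr (hx x hxX).1 (hx x hxX).2 y).2

/-- … and on the complement side (class `Q` with `Q ⇒ ¬P`). [g100] -/
theorem schemeDominatedOnP_splice_of_compl {ϱ α : ℝ} {a b : E3} {w : ℤ → E3} {np₁ np₂ : (Cell 2 × ℤ) × (Cell 2 × ℤ) → ℕ}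
    {z₁ z₂ : (Cell 2 × ℤ) × (Cell 2 × ℤ) → ℕ → Cell 2 × ℤ} {P Q : (Cell 2 × ℤ) × (Cell 2 × ℤ) → Prop} [DecidablePred P]
    {ΘR ΘN : (Cell 2 × ℤ) × (Cell 2 × ℤ) → ℝ} (hQ : ∀ x, Q x → ¬P x) (h : SchemeDominatedOnP ϱ α a b w np₂ z₂ Q ΘR ΘN) :
    SchemeDominatedOnP ϱ α a b w (fun x => if P x then np₁ x else np₂ x) (fun x => if P x then z₁ x else z₂ x) Q ΘR ΘN := by
  classical
  intro X hX y
  have hx : ∀ x ∈ X, (fun x => if P x then np₁ x else np₂ x) x = np₂ x ∧ (fun x => if P x then z₁ x else z₂ x) x = z₂ x :=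
    fun x hx => by constructor <;> simp only [hQ x (hX x hx).2, if_false]
  obtain ⟨hR, hN⟩ := h X hX y
  constructor
  · refine le_trans (le_of_eq (Finset.sum_congr rfl fun x hxX => ?_)) hR
    exact (schemeSums_congr (hx x hxX).1 (hx x hxX).2 y).1
  · refine le_trans (le_of_eq (Finset.sum_congr rfl fun x hxX => ?_)) hN
    exact (schemeSums_congr (hx x hxX).1 (hx x hxX).2 y).2

/-! ### §7 periodicity and the base representative -/

/-- letters of a `{0,1,2}`-word are in `[0, 2]` (the default letter is `0`). [g100] -/
theorem regW_bounds {wd : List ℤ} (h : ∀ c ∈ wd, 0 ≤ c ∧ c ≤ 2) (m : ℤ) : 0 ≤ regW wd m ∧ regW wd m ≤ 2 := by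
  unfold regW
  rcases lt_or_ge ((m % (wd.length : ℤ)).toNat) wd.length with hlt | hge
  · rw [List.getD_eq_getElem _ _ hlt]; exact h _ (List.getElem_mem hlt)
  · rw [List.getD_eq_default _ _ hge]; norm_num

/-- `regW` is periodic with period `wd.length`. [g100] -/
theorem regW_add_mul (wd : List ℤ) (m k : ℤ) : regW wd (m + (wd.length : ℤ) * k) = regW wd m := by
  unfold regW; rw [Int.add_mul_emod_self_left]

/-- `n9W` is invariant under a common in-plane translation and a common layer shift by a multiple of the period. [g100] -/
theorem n9W_shift (wd : List ℤ) (γ : Cell 2) (k : ℤ) (x : (Cell 2 × ℤ) × (Cell 2 × ℤ)) :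
    n9W wd (shiftSiteW γ ((wd.length : ℤ) * k) x.1, shiftSiteW γ ((wd.length : ℤ) * k) x.2) = n9W wd x := by
  simp only [n9W, refW0, refW1, shiftSiteW, regW_add_mul, Pi.add_apply]
  ring

/-- the base shift is a multiple of the period: `baseShift p x = p·(x.1.2 / p)`. [g100] -/
theorem baseShift_eq (p : ℕ) (x : (Cell 2 × ℤ) × (Cell 2 × ℤ)) : baseShift p x = (p : ℤ) * (x.1.2 / (p : ℤ)) := by
  unfold baseShift; rw [Int.emod_def]; ring

/-- ★ the ideal length of a pair is that of its base representative. [g100] -/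
theorem n9W_toBase (wd : List ℤ) (x : (Cell 2 × ℤ) × (Cell 2 × ℤ)) : n9W wd (toBase wd.length x) = n9W wd x := by
  have h : -baseShift wd.length x = (wd.length : ℤ) * (-(x.1.2 / (wd.length : ℤ))) := by rw [baseShift_eq]; ring
  unfold toBase; rw [h]; exact n9W_shift wd _ _ x

/-- the ideal near class read on the pair itself. [g100] -/
theorem idealNear_iff (wd : List ℤ) (hi : ℤ) (x : (Cell 2 × ℤ) × (Cell 2 × ℤ)) : IdealNear wd hi x ↔ n9W wd x ≤ hi := by
  unfold IdealNear; rw [n9W_toBase]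

/-- a BASED pair (`x.1 = (0, m)`, `0 ≤ m < p`) is its own base representative (data lookup of the listed chords). [g100] -/
theorem toBase_of_based {p : ℕ} {x : (Cell 2 × ℤ) × (Cell 2 × ℤ)} (h0 : x.1.1 = 0) (hm : 0 ≤ x.1.2) (hp : x.1.2 < (p : ℤ)) :
    toBase p x = x := by
  obtain ⟨⟨γ, m⟩, ⟨γ', m'⟩⟩ := x
  simp only at h0 hm hp
  subst h0
  have hs : baseShift p ((0, m), (γ', m')) = 0 := by
    show m - m % (p : ℤ) = 0
    rw [Int.emod_eq_of_lt hm hp, sub_self]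
  simp only [toBase, shiftSiteW, hs, neg_zero, add_zero]

end Summit.AtomisticToContinuum.Crystallization.Theorems.ChartedZeroExcessLayeredLatticeLiouville
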